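import Literature.AnabelianGeometry.EtaleTheta.Discharge.Sec1Rmk131ModelChiThetaData
import Literature.AnabelianGeometry.EtaleTheta.SettingModelChiKummerDataCusp
import HarnessLib

/-!
# [EtTh] Rmk. 1.3.1 at the CUSPED χ-twisted root model `ThetaSetting.modelχ′` (the `modelχ′` column of the
# Rmk. 1.3.1 NV rows; proof-only twins of `Sec1Rmk131ModelChiNoHalf` / `Sec1Rmk131ModelChiThetaData`)

S. Mochizuki, *The étale theta function …*, Publ. RIMS **45** (2009) [EtTh], §1, Rmk. 1.3.1, PRIMS PDF p. 21
l. 31–33 ("the denominators `½` in Proposition 1.3 are by no means superfluous … the divisor `D₁` on `Ÿ` clearly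
does not descend to `Y`"), Prop. 1.5 p. 23 l. 64 ("`log(Ü) = ½ · log(U)`") [cite: MochizukiEtTh2009, Rmk 1.3.1 p.21].

PROOF-ONLY companion (abc-iut cell, block F, seat abc-iut-f-117 gen 4; FACT-LIST row F-0523 `ThetaSetting.Rmk131`,
instance forms at the SECOND stage-1 model; no `def`, no instance, no Prop fact).  abc-iut-w5-d029's cusped model
`ThetaSetting.modelχ′ p` (F5c, `SettingModelChiThetaCusp`: the groups of abc-iut-L2-t1's `modelχ` WITH the synthetic
cusp `D_x = b^Ẑ ⋊ G_{ℚ_p}`) carries abc-iut-w5-d171's Kummer datum `kummerDataχ′` (`SettingModelChiKummerDataCusp`),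
whose core is FIELD-BY-FIELD that of `modelχ` — same theta quotient, same `Δ_Θ`-coordinates, same coordinate classes
`log(U) = logUχ`, `log(Ü) = logUddχ`, same unit Kummer classes (all definitionally).  Hence every Rmk. 1.3.1
statement proved at `modelχ` holds VERBATIM at `modelχ′`; this file records the `modelχ′` column of the NV table
(format of abc-iut-L2-t10's `SettingModelChiCensusClauses`):

| NV row (Rmk. 1.3.1 at stage 1) | modelχ | modelχ′ | decl (modelχ′) |
|---|---|---|---|
| `log(U)` has no square root over `Y` | HOLDS | HOLDS | `logU_not_sq_modelχ'` |
| … nor `log(U)·κ(u)`, any Kummer class `κ(u)` | HOLDS | HOLDS | `logU_mul_kumY_not_sq_modelχ'` |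
| `res : H¹((Π^tp_Y)^Θ,Δ_Θ) → H¹((Π^tp_Ÿ)^Θ,Δ_Θ)` injective | HOLDS | HOLDS | `res_gtpYdd_injective_modelχ'` |
| `log(Ü)` does not descend to `Y` («`D₁` does not descend») | HOLDS | HOLDS | `logUdd_not_mem_range_res_modelχ'` |
| `Rmk131 (ofClass (infl log(Ü)))` over the genuine Kummer datum | TRUE | TRUE | `rmk131_etaleThetaDataOfClass_infl_logUdd_modelχ'` |
| `Rmk131 (ofClass 1)` | FALSE | FALSE | `not_rmk131_etaleThetaDataOfClass_one_modelχ'` |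
| `∀ η̈, Rmk131(η̈) ∨ Rmk131(η̈·log(Ü))` | HOLDS | HOLDS | `rmk131_etaleThetaDataOfClass_or_mul_logUdd_modelχ'` |

HONEST FRAMING: stage-1 semi-synthetic models (the synthetic cusp of `modelχ′` is the toral `b`-axis), consistency
evidence only; `η̈ := log(Ü)` is NOT print's `η̈^Θ`; nothing of [EtTh] is asserted; no side is taken on [IUTchIII]
Cor. 3.12; typed ≠ proved.
-/

noncomputable section

namespace Literature.AnabelianGeometry.EtaleTheta.SettingModel

open Literature.AnabelianGeometry.SemiGraphs ThetaSetting

variable (p : ℕ) [Fact p.Prime]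

/-! ### The Kummer-class rows at `modelχ′` -/

/-- **`log(U)` has no square root over `Y` at `modelχ′`** (`(kummerDataχ′).logU = logUχ` definitionally).
[cite: MochizukiEtTh2009, Rmk 1.3.1 p.21] -/
theorem logU_not_sq_modelχ'
    (z : (ThetaSetting.modelχ' p).H1Theta ((ThetaSetting.modelχ' p).GtpY.map (ThetaSetting.modelχ' p).toTheta)) :
    z ^ 2 ≠ (kummerDataχ' p).logU :=
  logUχ_not_sq p z

/-- … nor has `log(U) · κ(u)` for any Kummer class `κ(u)` of `kummerDataχ′`. [cite: MochizukiEtTh2009, Rmk 1.3.1 p.21] -/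
theorem logU_mul_kumY_not_sq_modelχ' (u : ↥(kummerCoreχ' p).invY)
    (z : (ThetaSetting.modelχ' p).H1Theta ((ThetaSetting.modelχ' p).GtpY.map (ThetaSetting.modelχ' p).toTheta)) :
    z ^ 2 ≠ (kummerDataχ' p).logU * (kummerDataχ' p).kumY u :=
  logUχ_mul_kumY_not_sq p u z

/-- **Restriction `H¹((Π^tp_Y)^Θ, Δ_Θ) → H¹((Π^tp_Ÿ)^Θ, Δ_Θ)` is injective at `modelχ′`.**
[cite: MochizukiEtTh2009, Prop 1.5 p.23] -/
theorem res_gtpYdd_injective_modelχ' :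
    Function.Injective (ContH1.res (MonoidHom.id (ThetaSetting.modelχ' p).GtpTheta) (ThetaSetting.modelχ' p).DeltaTheta
      (ThetaSetting.modelχ' p).GtpYddTheta_le) :=
  res_gtpYdd_injective_modelχ p

/-- **«`D₁` on `Ÿ` does not descend to `Y`» at `modelχ′`**: `log(Ü)` is not the restriction of any class over `Y`.
[cite: MochizukiEtTh2009, Rmk 1.3.1 p.21] -/
theorem logUdd_not_mem_range_res_modelχ' :
    (kummerDataχ' p).logUdd ∉ Set.range (ContH1.res (MonoidHom.id (ThetaSetting.modelχ' p).GtpTheta)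
      (ThetaSetting.modelχ' p).DeltaTheta (ThetaSetting.modelχ' p).GtpYddTheta_le) :=
  logUddχ_not_mem_range_res p

/-- … while `log(U)|_Ÿ = log(Ü)²` IS a square over `Ÿ` at `modelχ′`. [cite: MochizukiEtTh2009, Prop 1.5 p.23] -/
theorem res_logU_mem_range_sq_modelχ' :
    ContH1.res (MonoidHom.id (ThetaSetting.modelχ' p).GtpTheta) (ThetaSetting.modelχ' p).DeltaTheta
        (ThetaSetting.modelχ' p).GtpYddTheta_le (kummerDataχ' p).logU ∈
      Set.range (fun z :
        (ThetaSetting.modelχ' p).H1Theta ((ThetaSetting.modelχ' p).GtpYdd.map (ThetaSetting.modelχ' p).toTheta) =>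
          z ^ 2) :=
  res_logUχ_mem_range_sq p

/-! ### The typed `Rmk131` at étale-theta data over `kummerDataχ′` -/

/-- The unit Kummer classes of `kummerDataχ′` on `Π^tp_Ÿ` are those of `kummerDataχ` (definitionally: the cusped
core is the core of `modelχ` field by field). [cite: MochizukiEtTh2009, Prop 1.5 p.23] -/
theorem kumUnitsModHom_kummerDataχ' (a : (ThetaSetting.modelχ' p).unitsOKmodKdd) :
    (kummerDataχ' p).kumUnitsModHom a = (kummerDataχ p).kumUnitsModHom a := rfl

/-- At `modelχ′`: no unit translate of `log(Ü)` descends to `Π^tp_Y`. [cite: MochizukiEtTh2009, Rmk 1.3.1 p.21] -/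
theorem kumUnitsModHom_mul_infl_logUdd_ne_res_modelχ' (a : (ThetaSetting.modelχ' p).unitsOKmodKdd)
    (x : (ThetaSetting.modelχ' p).H1 (ThetaSetting.modelχ' p).GtpY) :
    (kummerDataχ' p).kumUnitsModHom a *
        (ThetaSetting.modelχ' p).inflTheta (ThetaSetting.modelχ' p).GtpYdd (kummerDataχ' p).logUdd ≠
      ContH1.res (ThetaSetting.modelχ' p).toTheta (ThetaSetting.modelχ' p).DeltaTheta
        (ThetaSetting.modelχ' p).GtpYdd_le_GtpY x :=
  kumUnitsModHom_mul_infl_logUddχ_ne_res p a x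

/-- **F-0523 instance form at `modelχ′` — Rmk. 1.3.1 as typed HOLDS** for the étale-theta datum over `kummerDataχ′`
with `η̈ := log(Ü)` (honest-degenerate `½`-groups). [cite: MochizukiEtTh2009, Rmk 1.3.1 p.21] -/
theorem rmk131_etaleThetaDataOfClass_infl_logUdd_modelχ' :
    Rmk131 ((kummerDataχ' p).etaleThetaDataOfClass
      ((ThetaSetting.modelχ' p).inflTheta (ThetaSetting.modelχ' p).GtpYdd (kummerDataχ' p).logUdd)) := by
  rw [KummerData.rmk131_etaleThetaDataOfClass_iff]
  exact kumUnitsModHom_mul_infl_logUdd_ne_res_modelχ' p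

/-- … and FAILS for `η̈ := 1`. [cite: MochizukiEtTh2009, Rmk 1.3.1 p.21] -/
theorem not_rmk131_etaleThetaDataOfClass_one_modelχ' :
    ¬ Rmk131 ((kummerDataχ' p).etaleThetaDataOfClass 1) := by
  rw [KummerData.rmk131_etaleThetaDataOfClass_iff]
  intro h
  exact h 1 1 (by rw [map_one, one_mul, map_one])

/-- **The `½`-dichotomy at `modelχ′`.** [cite: MochizukiEtTh2009, Rmk 1.3.1 p.21] -/
theorem rmk131_etaleThetaDataOfClass_or_mul_logUdd_modelχ'
    (η : (ThetaSetting.modelχ' p).H1 (ThetaSetting.modelχ' p).GtpYdd) :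
    Rmk131 ((kummerDataχ' p).etaleThetaDataOfClass η) ∨
      Rmk131 ((kummerDataχ' p).etaleThetaDataOfClass
        (η * (ThetaSetting.modelχ' p).inflTheta (ThetaSetting.modelχ' p).GtpYdd (kummerDataχ' p).logUdd)) :=
  rmk131_etaleThetaDataOfClass_or_mul_logUddχ p η

/-- CENSUS at `modelχ′`: both truth values of the typed Rmk. 1.3.1 occur over the ONE genuine Kummer datum
`kummerDataχ′` (each with `Prop13`). [cite: MochizukiEtTh2009, Rmk 1.3.1 p.21] -/
theorem exists_rmk131_and_exists_not_rmk131_kummerDataχ' :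
    (∃ E : (ThetaSetting.modelχ' p).EtaleThetaData, E.toKummerData = kummerDataχ' p ∧ Rmk131 E ∧ Prop13 E) ∧
      ∃ E : (ThetaSetting.modelχ' p).EtaleThetaData, E.toKummerData = kummerDataχ' p ∧ ¬ Rmk131 E ∧ Prop13 E :=
  ⟨⟨_, rfl, rmk131_etaleThetaDataOfClass_infl_logUdd_modelχ' p, (kummerDataχ' p).prop13_etaleThetaDataOfClass _⟩,
    ⟨_, rfl, not_rmk131_etaleThetaDataOfClass_one_modelχ' p, (kummerDataχ' p).prop13_etaleThetaDataOfClass _⟩⟩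

/-- Both stage-1 models at once: at `modelχ` AND at `modelχ′` the typed Rmk. 1.3.1 is witnessed TRUE (by
`η̈ := log(Ü)`) over the genuine Kummer datum. [cite: MochizukiEtTh2009, Rmk 1.3.1 p.21] -/
theorem exists_rmk131_modelχ_and_modelχ' :
    (∃ E : (ThetaSetting.modelχ p).EtaleThetaData, E.toKummerData = kummerDataχ p ∧ Rmk131 E) ∧
      ∃ E : (ThetaSetting.modelχ' p).EtaleThetaData, E.toKummerData = kummerDataχ' p ∧ Rmk131 E :=
  ⟨⟨_, rfl, rmk131_etaleThetaDataOfClass_infl_logUddχ p⟩,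
    ⟨_, rfl, rmk131_etaleThetaDataOfClass_infl_logUdd_modelχ' p⟩⟩

end Literature.AnabelianGeometry.EtaleTheta.SettingModel

end
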